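import Literature.Analysis.FluidPDE.ReleaseLogBoundEvolution
import HarnessLib

/-!
# The logarithmic separation functional of the reversed kernel family, II: time integration

Analysis/FluidPDE proof-support file (everything proved). Continuation of
`FluidPDE/ReleaseLogBoundEvolution`: for the reversed kernel family `χ^w` of a smooth
divergence-free drift `u` on `[0,T] × T^d` (`κ = δ²`, mollifier radius `ε`) and the periodic
logarithmic cost `Φ_δ`, the separation functional
`Q(τ) = ∫ ∫∫ Φ_δ(x-y) χ^w(τ,x) χ^w(τ,y) dx dy dw` obeys

  `Q(T) ≤ Q(0) + 4π² d T + 2π (C_d d)^{1/2} S`   whenever `∫₀ᵀ ‖∇u(t)‖_{L²} dt ≤ S`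

(`integral_pairT_reversedKernel_le`): the evolution identity of the pair functional
(`TwoPointPairFunctional`) for every `w`, Fubini in `(w, τ)` (joint continuity of the generator,
by clamping the time variable to `[0,T]`), and the `w`-integrated generator bound of part I.

## References

* G. Crippa, C. De Lellis, J. reine angew. Math. 616 (2008), Thm. 2.1 / §2.
* C. Seis, Comm. Math. Phys. 399 (2023) = arXiv:2003.08794, §2.2. [`Seis2022`]
-/

noncomputable section

open MeasureTheory Set Filter Topology Function Metric Real
open scoped InnerProductSpace ENNReal Convolution
open Literature.Analysis.FunctionSpaces Literature.Analysis.FunctionSpaces.Torus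
open Literature.Analysis.SingularIntegrals Literature.Analysis.SingularIntegrals.Torus

namespace Literature.Analysis.FluidPDE

namespace Torus

variable {d : Type*} [Fintype d] [DecidableEq d]

section PairT

variable {κ T ε δ : ℝ} {u : ℝ → UnitAddTorus d → EuclideanSpace ℝ d}
  {χ : UnitAddTorus d → ℝ → UnitAddTorus d → ℝ}

omit [DecidableEq d] in
/-- Pulling the first factor out of a pair integral. [folklore] -/
theorem integral_integral_pair_eq (φ : UnitAddTorus d → ℝ) (f : UnitAddTorus d → ℝ) (K : UnitAddTorus d → UnitAddTorus d → ℝ) :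
    ∫ x, ∫ y, φ (x - y) * (f x * f y) * K x y = ∫ x, f x * ∫ y, f y * (φ (x - y) * K x y) := by
  refine integral_congr_ae (Eventually.of_forall fun x => ?_)
  simp only
  rw [← integral_const_mul]
  exact integral_congr_ae (Eventually.of_forall fun y => by ring)

/-- **The time-continuity of the strain of a smooth drift**: `τ ↦ gradNormSq (u (T - τ))` is
continuous on `[0,T]`. [folklore] -/
theorem continuousOn_gradNormSq_reverse (hT : 0 < T) (hu : FunctionSpaces.Torus.IsSmoothSpaceTimeOn (Icc 0 T) u) :
    ContinuousOn (fun τ => gradNormSq (u (T - τ))) (Icc 0 T) := by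
  have hur : FunctionSpaces.Torus.IsSmoothSpaceTimeOn (Icc 0 T) (fun τ => u (T - τ)) :=
    IsSmoothSpaceTimeOn.reverse hu
  have hU : UniqueDiffOn ℝ (Icc 0 T) := uniqueDiffOn_Icc hT
  have hP : FunctionSpaces.Torus.IsSmoothSpaceTimeOn (Icc 0 T)
      (fun τ x => ∑ i, ⟪FunctionSpaces.Torus.partialDeriv i (u (T - τ)) x, FunctionSpaces.Torus.partialDeriv i (u (T - τ)) x⟫_ℝ) :=
    IsSmoothSpaceTimeOn.sum fun i _ => (hur.partialDeriv hU i).inner (hur.partialDeriv hU i)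
  refine (hP.continuousOn_integral (convex_Icc 0 T)).congr fun τ _ => ?_
  simp only [gradNormSq, real_inner_self_eq_norm_sq]

/-- **Evolution of the separation functional of the reversed kernels.** With
`∫₀ᵀ ‖∇u(t)‖_{L²} dt ≤ S` (spectral gradient norm, lower Lebesgue integral in time):
`∫ (∫∫ Φ_δ(x-y) χ^w(T,x)χ^w(T,y)) dw ≤ ∫ (∫∫ Φ_δ(x-y) k_ε(x-w)k_ε(y-w)) dw + 4π² d T + 2π √(C_d d) S`.
[folklore] -/
theorem integral_pairT_reversedKernel_le (hκ : 0 < κ) (hT : 0 < T)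
    (hu : FunctionSpaces.Torus.IsSmoothSpaceTimeOn (Icc 0 T) u)
    (hdiv : ∀ t ∈ Icc 0 T, IsDivFree (u t)) (hε : 0 < ε) (hε4 : ε ≤ 1 / 4)
    (hχ : ∀ w, IsClassicalScalarTransportOn (Icc 0 T) κ (fun τ x => -u (T - τ) x) (χ w))
    (hχ0 : ∀ w x, χ w 0 x = kernel ε (x - w)) (hδ : 0 < δ) (hκδ : κ = δ ^ 2)
    {S : ℝ} (hS0 : 0 ≤ S) (hS : ∫⁻ t in Ioo 0 T, eGradNormSq (u t) ^ (1 / 2 : ℝ) ≤ ENNReal.ofReal S) :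
    ∫ w, ∫ x, ∫ y, sinLogCost δ (x - y) * (χ w T x * χ w T y) ≤
      (∫ w : UnitAddTorus d, ∫ x, ∫ y, sinLogCost δ (x - y) * (kernel ε (x - w) * kernel ε (y - w))) +
        4 * π ^ 2 * Fintype.card d * T +
          2 * π * Real.sqrt ((twoPointL2Const d).toReal * Fintype.card d) * S := by
  have hTI : T ∈ Icc 0 T := right_mem_Icc.2 hT.le
  have h0I : (0 : ℝ) ∈ Icc 0 T := left_mem_Icc.2 hT.le
  set φ : UnitAddTorus d → ℝ := sinLogCost δ with hφ
  have hφs : IsSmooth φ := isSmooth_sinLogCost δ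
  have hφe : ∀ z, φ (-z) = φ z := sinLogCost_neg δ
  -- the generator kernel, clamped in time
  set cl : ℝ → ℝ := fun τ => ((projIcc 0 T hT.le τ : Icc 0 T) : ℝ) with hcl
  have hclc : Continuous cl := continuous_subtype_val.comp continuous_projIcc
  have hclI : ∀ τ, cl τ ∈ Icc 0 T := fun τ => (projIcc 0 T hT.le τ).2
  have hcl_of : ∀ τ ∈ Icc 0 T, cl τ = τ := fun τ hτ => by simp only [hcl, projIcc_of_mem hT.le hτ]
  set K : ℝ → UnitAddTorus d → UnitAddTorus d → ℝ := fun τ x y =>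
    κ * FunctionSpaces.Torus.laplacian φ (x - y) + ⟪-u (T - τ) x, Torus.gradient φ (x - y)⟫_ℝ with hK
  set I : UnitAddTorus d → ℝ → ℝ := fun w τ => 2 * ∫ x, χ w τ x * ∫ y, χ w τ y * K τ x y with hI
  -- (a) the evolution identity for each `w`
  have hA : ∀ w, (∫ x, ∫ y, φ (x - y) * (χ w T x * χ w T y)) =
      (∫ x : UnitAddTorus d, ∫ y, φ (x - y) * (kernel ε (x - w) * kernel ε (y - w))) + ∫ τ in (0 : ℝ)..T, I w τ := by
    intro w
    have h := (hχ w).pair_functional_sub_eq hT hφs hφe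
    simp_rw [hχ0] at h
    linarith
  -- (b) joint continuity of the clamped generator
  have hχcl : Continuous (fun q : UnitAddTorus d × ℝ × UnitAddTorus d => χ q.1 (cl q.2.1) q.2.2) := by
    have h := continuousOn_reversedKernel hκ.le hε hε4 hχ hχ0
    exact h.comp_continuous (continuous_fst.prodMk ((hclc.comp continuous_snd.fst).prodMk continuous_snd.snd))
      fun q => ⟨mem_univ _, hclI _, mem_univ _⟩
  have hucl : Continuous (fun q : ℝ × UnitAddTorus d => u (T - cl q.1) q.2) := by
    have h := hu.continuousOn_uncurry
    have hm : Continuous (fun q : ℝ × UnitAddTorus d => ((T - cl q.1, q.2) : ℝ × UnitAddTorus d)) :=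
      (continuous_const.sub (hclc.comp continuous_fst)).prodMk continuous_snd
    have hmaps : ∀ q : ℝ × UnitAddTorus d, ((T - cl q.1, q.2) : ℝ × UnitAddTorus d) ∈ Icc 0 T ×ˢ (univ : Set (UnitAddTorus d)) :=
      fun q => ⟨⟨sub_nonneg.2 (hclI q.1).2, sub_le_self _ (hclI q.1).1⟩, mem_univ _⟩
    exact h.comp_continuous hm hmaps
  have hLc : Continuous (FunctionSpaces.Torus.laplacian φ : UnitAddTorus d → ℝ) := continuous_laplacian_sinLogCost δ
  have hGc : Continuous (Torus.gradient φ : UnitAddTorus d → EuclideanSpace ℝ d) := continuous_gradient_sinLogCost δ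
  -- the clamped integrand on `(w, τ) × (x, y)`
  have hJ : Continuous (fun q : (UnitAddTorus d × ℝ) × (UnitAddTorus d × UnitAddTorus d) =>
      χ q.1.1 (cl q.1.2) q.2.1 * (χ q.1.1 (cl q.1.2) q.2.2 * K (cl q.1.2) q.2.1 q.2.2)) := by
    have h1 : Continuous (fun q : (UnitAddTorus d × ℝ) × (UnitAddTorus d × UnitAddTorus d) => χ q.1.1 (cl q.1.2) q.2.1) :=
      hχcl.comp (continuous_fst.fst.prodMk (continuous_fst.snd.prodMk continuous_snd.fst))
    have h2 : Continuous (fun q : (UnitAddTorus d × ℝ) × (UnitAddTorus d × UnitAddTorus d) => χ q.1.1 (cl q.1.2) q.2.2) :=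
      hχcl.comp (continuous_fst.fst.prodMk (continuous_fst.snd.prodMk continuous_snd.snd))
    have h3 : Continuous (fun q : (UnitAddTorus d × ℝ) × (UnitAddTorus d × UnitAddTorus d) => K (cl q.1.2) q.2.1 q.2.2) := by
      have hu' : Continuous (fun q : (UnitAddTorus d × ℝ) × (UnitAddTorus d × UnitAddTorus d) => u (T - cl q.1.2) q.2.1) :=
        hucl.comp (continuous_fst.snd.prodMk continuous_snd.fst)
      exact (continuous_const.mul (hLc.comp (continuous_snd.fst.sub continuous_snd.snd))).add
        (hu'.neg.inner (hGc.comp (continuous_snd.fst.sub continuous_snd.snd)))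
    exact h1.mul (h2.mul h3)
  have hIt' := continuous_parametric_integral_of_continuous
    (f := fun (p : UnitAddTorus d × ℝ) (q : UnitAddTorus d × UnitAddTorus d) =>
      χ p.1 (cl p.2) q.1 * (χ p.1 (cl p.2) q.2 * K (cl p.2) q.1 q.2))
    hJ (isCompact_univ (X := UnitAddTorus d × UnitAddTorus d)) (μ := volume)
  have hIt : Continuous (fun p : UnitAddTorus d × ℝ =>
      ∫ q : UnitAddTorus d × UnitAddTorus d, χ p.1 (cl p.2) q.1 * (χ p.1 (cl p.2) q.2 * K (cl p.2) q.1 q.2)) := by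
    refine hIt'.congr fun p => ?_
    rw [Measure.restrict_univ]
  -- the clamped generator agrees with `I` on `[0,T]`
  have hIeq : ∀ w, ∀ τ ∈ Icc 0 T, I w τ =
      2 * ∫ q : UnitAddTorus d × UnitAddTorus d, χ w (cl τ) q.1 * (χ w (cl τ) q.2 * K (cl τ) q.1 q.2) := by
    intro w τ hτ
    rw [hcl_of τ hτ]
    have hc : Continuous (fun q : UnitAddTorus d × UnitAddTorus d => χ w τ q.1 * (χ w τ q.2 * K τ q.1 q.2)) := by
      have hfc : Continuous (χ w τ) := ((hχ w).smooth_scalar.isSmooth_slice hτ).continuous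
      have hTτ : T - τ ∈ Icc 0 T := ⟨by linarith [hτ.2], by linarith [hτ.1]⟩
      have huc : Continuous (u (T - τ)) := (hu.isSmooth_slice hTτ).continuous
      have hKτ : Continuous (fun q : UnitAddTorus d × UnitAddTorus d => K τ q.1 q.2) :=
        (continuous_const.mul (hLc.comp (continuous_fst.sub continuous_snd))).add
          ((huc.comp continuous_fst).neg.inner (hGc.comp (continuous_fst.sub continuous_snd)))
      exact (hfc.comp continuous_fst).mul ((hfc.comp continuous_snd).mul hKτ)
    simp only [hI]
    rw [integral_prod_of_continuous hc]
    congr 1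
    refine integral_congr_ae (Eventually.of_forall fun x => ?_)
    simp only
    rw [← integral_const_mul]
  -- (c) Fubini in `(w, τ)` and the slice bounds
  set B : ℝ → ℝ := fun τ => 4 * π ^ 2 * Fintype.card d +
    2 * π * Real.sqrt ((twoPointL2Const d).toReal * (Fintype.card d * gradNormSq (u (T - τ)))) with hB
  have hBc : ContinuousOn B (Icc 0 T) :=
    continuousOn_const.add (continuousOn_const.mul ((continuousOn_const.mul
      (continuousOn_const.mul (continuousOn_gradNormSq_reverse hT hu))).sqrt))
  have hslice : ∀ τ ∈ Icc 0 T, ∫ w, I w τ ≤ B τ := fun τ hτ =>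
    integral_generator_reversedKernel_le hκ hu hdiv hε hε4 hχ hχ0 hδ hκδ hτ
  -- the continuous version `Ic` of `I` on `T^d × ℝ`
  set Ic : UnitAddTorus d × ℝ → ℝ := fun p =>
    2 * ∫ q : UnitAddTorus d × UnitAddTorus d, χ p.1 (cl p.2) q.1 * (χ p.1 (cl p.2) q.2 * K (cl p.2) q.1 q.2) with hIc
  have hIcc : Continuous Ic := continuous_const.mul hIt
  have hIcI : ∀ w, ∀ τ ∈ Icc 0 T, Ic (w, τ) = I w τ := fun w τ hτ => (hIeq w τ hτ).symm
  obtain ⟨CI, hCI⟩ := (isCompact_univ.prod (isCompact_Icc (a := (0 : ℝ)) (b := T))).exists_bound_of_continuousOn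
    hIcc.continuousOn
  -- integrability of `Ic` on `T^d × (0, T]` (the bound holds everywhere, `Ic` being clamped)
  have hbdI : ∀ p : UnitAddTorus d × ℝ, ‖Ic p‖ ≤ CI := fun p => by
    have h := hCI (p.1, cl p.2) ⟨mem_univ _, hclI _⟩
    have e : Ic (p.1, cl p.2) = Ic p := by simp only [hIc, hcl_of _ (hclI p.2)]
    rwa [e] at h
  have hInt : Integrable Ic ((volume : Measure (UnitAddTorus d)).prod (volume.restrict (Ioc 0 T))) :=
    Integrable.mono' (integrable_const CI) hIcc.aestronglyMeasurable (Eventually.of_forall hbdI)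
  have hswap : ∫ w, ∫ τ in (0 : ℝ)..T, I w τ = ∫ τ in Ioc 0 T, ∫ w, Ic (w, τ) := by
    have e1 : ∀ w, ∫ τ in (0 : ℝ)..T, I w τ = ∫ τ in Ioc 0 T, Ic (w, τ) := by
      intro w
      rw [intervalIntegral.integral_of_le hT.le]
      refine setIntegral_congr_fun measurableSet_Ioc fun τ hτ => ?_
      exact (hIcI w τ (Ioc_subset_Icc_self hτ)).symm
    simp_rw [e1]
    exact integral_integral_swap hInt
  have hτint : IntegrableOn (fun τ => ∫ w, Ic (w, τ)) (Ioc 0 T) := hInt.integral_prod_right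
  have hBint : IntegrableOn B (Ioc 0 T) := (hBc.integrableOn_Icc).mono_set Ioc_subset_Icc_self
  have hmono : ∫ τ in Ioc 0 T, ∫ w, Ic (w, τ) ≤ ∫ τ in Ioc 0 T, B τ := by
    refine setIntegral_mono_on hτint hBint measurableSet_Ioc fun τ hτ => ?_
    have hτ' := Ioc_subset_Icc_self hτ
    simp_rw [hIcI _ τ hτ']
    exact hslice τ hτ'
  -- (d) the time integral of `B`
  have hBval : ∫ τ in Ioc 0 T, B τ ≤ 4 * π ^ 2 * Fintype.card d * T +
      2 * π * Real.sqrt ((twoPointL2Const d).toReal * Fintype.card d) * S := by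
    set G : ℝ → ℝ := fun t => Real.sqrt (gradNormSq (u t)) with hG
    have hsq : ∀ τ, Real.sqrt ((twoPointL2Const d).toReal * (Fintype.card d * gradNormSq (u (T - τ)))) =
        Real.sqrt ((twoPointL2Const d).toReal * Fintype.card d) * G (T - τ) := fun τ => by
      rw [hG, ← Real.sqrt_mul (by positivity), mul_assoc]
    have hGc : ContinuousOn (fun τ => G (T - τ)) (Icc 0 T) := (continuousOn_gradNormSq_reverse hT hu).sqrt
    have hGi : IntegrableOn (fun τ => G (T - τ)) (Ioc 0 T) := hGc.integrableOn_Icc.mono_set Ioc_subset_Icc_self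
    have e1 : ∫ τ in Ioc 0 T, B τ = 4 * π ^ 2 * Fintype.card d * T +
        2 * π * Real.sqrt ((twoPointL2Const d).toReal * Fintype.card d) * ∫ τ in Ioc 0 T, G (T - τ) := by
      simp only [hB, hsq]
      rw [integral_add (integrable_const _) ((hGi.const_mul _).const_mul _),
        setIntegral_const, integral_const_mul, integral_const_mul]
      simp only [Real.volume_real_Ioc_of_le hT.le, sub_zero, smul_eq_mul]
      ring
    -- reflect the time and compare with the lower Lebesgue integral hypothesis
    have e2 : ∫ τ in Ioc 0 T, G (T - τ) = ∫ t in Ioo 0 T, G t := by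
      rw [← intervalIntegral.integral_of_le hT.le, intervalIntegral.integral_comp_sub_left (fun t => G t) T,
        sub_self, sub_zero, intervalIntegral.integral_of_le hT.le, integral_Ioc_eq_integral_Ioo]
    have hGc' : ContinuousOn G (Icc 0 T) := by
      have hU : UniqueDiffOn ℝ (Icc 0 T) := uniqueDiffOn_Icc hT
      have hP : FunctionSpaces.Torus.IsSmoothSpaceTimeOn (Icc 0 T)
          (fun t x => ∑ i, ⟪FunctionSpaces.Torus.partialDeriv i (u t) x, FunctionSpaces.Torus.partialDeriv i (u t) x⟫_ℝ) :=
        IsSmoothSpaceTimeOn.sum fun i _ => (hu.partialDeriv hU i).inner (hu.partialDeriv hU i)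
      refine ((hP.continuousOn_integral (convex_Icc 0 T)).congr fun t _ => ?_).sqrt
      simp only [gradNormSq, real_inner_self_eq_norm_sq]
    have hGi' : IntegrableOn G (Ioo 0 T) := hGc'.integrableOn_Icc.mono_set Ioo_subset_Icc_self
    have hG0 : ∀ t, 0 ≤ G t := fun t => Real.sqrt_nonneg _
    have e3 : ∫⁻ t in Ioo 0 T, eGradNormSq (u t) ^ (1 / 2 : ℝ) = ENNReal.ofReal (∫ t in Ioo 0 T, G t) := by
      rw [ofReal_integral_eq_lintegral_ofReal hGi' (Eventually.of_forall hG0)]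
      refine setLIntegral_congr_fun measurableSet_Ioo fun t ht => ?_
      rw [eGradNormSq_eq_ofReal_gradNormSq (hu.isSmooth_slice (Ioo_subset_Icc_self ht)),
        ENNReal.ofReal_rpow_of_nonneg (gradNormSq_nonneg _) (by norm_num)]
      show ENNReal.ofReal (gradNormSq (u t) ^ (1 / 2 : ℝ)) = ENNReal.ofReal (Real.sqrt (gradNormSq (u t)))
      rw [Real.sqrt_eq_rpow]
    have hle : ∫ t in Ioo 0 T, G t ≤ S := by
      have h := hS
      rw [e3] at h
      exact (ENNReal.ofReal_le_ofReal_iff hS0).1 h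
    rw [e1, e2]
    have : 0 ≤ 2 * π * Real.sqrt ((twoPointL2Const d).toReal * Fintype.card d) := by positivity
    nlinarith
  -- (e) assemble
  have hcont0 : Continuous (fun w : UnitAddTorus d => ∫ x : UnitAddTorus d, ∫ y, φ (x - y) * (kernel ε (x - w) * kernel ε (y - w))) := by
    have h := continuous_pair_integral_reversedKernel hκ.le hε hε4 hχ hχ0 h0I
      (K := fun x y => φ (x - y) * 1) ((hφs.continuous.comp (continuous_fst.sub continuous_snd)).mul continuous_const)
    refine h.congr fun w => ?_
    simp_rw [hχ0]
    rw [← integral_integral_pair_eq φ (fun x => kernel ε (x - w)) (fun _ _ => (1 : ℝ))]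
    simp
  have hcontT : Continuous (fun w : UnitAddTorus d => ∫ x, ∫ y, φ (x - y) * (χ w T x * χ w T y)) := by
    have h := continuous_pair_integral_reversedKernel hκ.le hε hε4 hχ hχ0 hTI
      (K := fun x y => φ (x - y) * 1) ((hφs.continuous.comp (continuous_fst.sub continuous_snd)).mul continuous_const)
    refine h.congr fun w => ?_
    rw [← integral_integral_pair_eq φ (fun x => χ w T x) (fun _ _ => (1 : ℝ))]
    simp
  have hcontI : Continuous (fun w : UnitAddTorus d => ∫ τ in (0 : ℝ)..T, I w τ) := by
    have : (fun w : UnitAddTorus d => ∫ τ in (0 : ℝ)..T, I w τ) = fun w =>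
        (∫ x, ∫ y, φ (x - y) * (χ w T x * χ w T y)) - ∫ x : UnitAddTorus d, ∫ y, φ (x - y) * (kernel ε (x - w) * kernel ε (y - w)) := by
      funext w; linarith [hA w]
    rw [this]
    exact hcontT.sub hcont0
  calc ∫ w, ∫ x, ∫ y, φ (x - y) * (χ w T x * χ w T y)
      = ∫ w, ((∫ x : UnitAddTorus d, ∫ y, φ (x - y) * (kernel ε (x - w) * kernel ε (y - w))) + ∫ τ in (0 : ℝ)..T, I w τ) :=
        integral_congr_ae (Eventually.of_forall hA)
    _ = (∫ w : UnitAddTorus d, ∫ x, ∫ y, φ (x - y) * (kernel ε (x - w) * kernel ε (y - w))) + ∫ w, ∫ τ in (0 : ℝ)..T, I w τ :=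
        integral_add hcont0.integrable_unitAddTorus hcontI.integrable_unitAddTorus
    _ ≤ (∫ w : UnitAddTorus d, ∫ x, ∫ y, φ (x - y) * (kernel ε (x - w) * kernel ε (y - w))) +
          (4 * π ^ 2 * Fintype.card d * T + 2 * π * Real.sqrt ((twoPointL2Const d).toReal * Fintype.card d) * S) := by
        rw [hswap]
        linarith [hmono.trans hBval]
    _ = _ := by ring

end PairT

end Torus

end Literature.Analysis.FluidPDE
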